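import Literature.Analysis.FluidPDE.CriticalRegularity
import Literature.Analysis.FluidPDE.KochTataru
import Literature.Analysis.UnboundedOperators.HeatSemigroup
import HarnessLib
import Literature.Analysis.FluidPDE.KatoViscosityScaling
import Literature.Analysis.FluidPDE.LpRealisation
import Literature.Analysis.FluidPDE.HeatExtensionDistribution
import Literature.Analysis.FluidPDE.BesovHeatContinuity
import Literature.Analysis.FluidPDE.BesovFreeEvolution
import Literature.Analysis.FluidPDE.KatoFixedPointMildBesov
import Literature.Analysis.FluidPDE.KatoPicardLp
import Literature.Analysis.FluidPDE.KatoLocalL3Scaling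
import Literature.Analysis.FluidPDE.MildL3Smooth
import Literature.Analysis.FluidPDE.KatoPicard
import Literature.Analysis.FluidPDE.LittlewoodPaleyBlockFn
import Literature.Analysis.FluidPDE.NSCriticalClosureBesov
import Literature.Analysis.FluidPDE.GKPCriticalElements
import Literature.Analysis.FluidPDE.BoundedRepresentative
import Literature.Analysis.FluidPDE.CriticalRegularityProofs
import Literature.Analysis.FluidPDE.CriticalSpacesProofs
import Literature.Analysis.FunctionSpaces.LittlewoodPaleyHeatProofs
import Literature.Analysis.FunctionSpaces.LittlewoodPaleyConvergenceProofs

/-!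
# Local mild solutions for critical Besov data: the assembly (Cannone–Planchon architecture)

Analysis/FluidPDE proof file (no definitions, no named facts) for the named fact
`Literature.Analysis.FluidPDE.exists_isBesovMildSolutionOn` (`CriticalRegularity.lean`;
Bahouri–Chemin–Danchin 2011, Thm. 5.40; Cannone 1995, Planchon 1996; Gallagher–Koch–Planchon 2016,
§1.2: for every divergence-free `u₀ ∈ Ḃ^{s_p}_{p,q}(ℝ³)`, `3 < p < ∞`, `1 ≤ q < ∞`, there is a
solution `NS(u₀)` of the Duhamel equation `u = e^{tΔ}u₀ - B(u,u)` in `𝓛^{1:∞}_{p,q}(T)` for some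
`T > 0`, and it lies in `C([0,T]; Ḃ^{s_p}_{p,q})`). The tree's rendering asks, for `ν > 0`,
`3 < p, q < ∞`, a weakly divergence-free field `u₀` with tempered distribution
`U₀ ∈ Ḃ^{-1+3/p}_{p,q}`, for a `T > 0` and a Besov mild solution `(u, U)` on `[0, T)` in the sense
of `IsBesovMildSolutionOn` (mild in the duality form of `MildSolution.lean`, measurable on
`(0,T) × ℝ³`, `U t` the distribution of `u t`, `U ∈ C([0,T); Ḃ^{-1+3/p}_{p,q})`, `u` in Kato's
class `K_∞` on `[0,T)`) with `u 0 = u₀`.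

The printed proofs (Kato 1984, §2; Lemarié-Rieusset 2016, Thm. 8.7 with the Picard scheme of the
proof of Thm. 7.5; GKP 2016, App. B) construct the solution by Picard iteration of
`u = e^{tΔ}u₀ - B(u,u)`, `B(u,v)(t) = ∫₀ᵗ e^{(t-s)Δ} ℙ∇·(u ⊗ v)(s) ds` (the tree's
`kochTataruBilinear`, viscosity `1`), in Kato's weighted space
`Y_T = {sup t^{(1-3/p)/2} ‖u(t)‖_{L^p} + sup t^{1/2} ‖u(t)‖_{L^∞} < ∞}`, the free evolution of
`Ḃ^{-(1-3/p)}_{p,q}` data being small in `Y_T` for small `T` when `q < ∞`. This file **proves the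
assembly** of that architecture from the pieces already in the tree,

* the free evolution: `isDistributionOf_heatExtension_of_eLpNormDistrib_lt_top'`
  (`HeatExtensionDistribution.lean`: `e^{tΔ}u₀` represents `e^{tΔ}U₀`) and
  `besov_heatExtension_kato_small'` (`BesovFreeEvolution.lean`: Kato smallness on `(0, T₀)`);
* Kato's fixed point with `L^p` weights and its localisation in time,
  `KatoLp.exists_katoLp_fixedPoint_heatTest` (`KatoPicardLp.lean`);
* the duality-form mildness of Kato-class fixed points, `isMildNSSolutionOn_of_kato_fixedPoint'`
  (`KatoFixedPointMildBesov.lean`);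
* the strong continuity of `e^{tΔ}` on `Ḃ^s_{p,q}`, `tendsto_eHomBesovNorm_heatSemigroup_sub`
  (`BesovHeatContinuity.lean`), and the realisation of `L^p` fields,
  `tendsto_lowFreqCutoff_of_memLp_of_isDistributionOf` (`LpRealisation.lean`);

**modulo one remaining analytic input, carried as an explicit hypothesis**: the Besov regularity
and time continuity of the Duhamel term of a Kato-class field (GKP 2016, App. B: the heat estimate
on the blocks, Bernstein, and the Kato-space bilinear estimates) — for `3 < p < ∞` a constant `C`
such that, whenever `‖u(s)‖_{L^p} ≤ a s^{-(1-3/p)/2}` and `|u(s)(x)| ≤ b s^{-1/2}` on `(0,T)`, the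
functions `B(u,u)(t)` have tempered distributions `V t` with `‖V t‖_{Ḃ^{-1+3/p}_{p,1}} ≤ C a b` and
`t ↦ V t` continuous on `(0,T)` in `Ḃ^{-1+3/p}_{p,1}`. The main results:

* `exists_isBesovMildSolutionOn_unit_of_duhamel` — unit viscosity: the free evolution is made
  small in Kato's norms on some `(0, T₀)`; Kato's fixed point `u` there is the solution (datum
  `u₀` at `t = 0`, zero after `T₀`); mildness in the duality form; `U t = e^{tΔ}U₀ - V t` represents `u t`,
  lies in `Ḃ^{-1+3/p}_{p,q}` (`Ḃ_{p,1} ⊂ Ḃ_{p,q}`, realisation from `L^p`) and is continuous in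
  `t`, at `t = 0` because `‖V t‖ ≤ C (2a₁)(4a₁) → 0` along the localised Kato bounds; Kato's class
  `K_∞` with `o(t^{-1/2})` at `0⁺` by the same localisation;
* `IsBesovMildSolutionOn.timeRescale_of_unit`, `MemKatoClassOn.timeRescale` — the passage from
  unit to general viscosity by `u(t,x) = ν w(νt, x)` (`IsMildNSSolutionOn.timeRescale`);
* `exists_isBesovMildSolutionOn_of_duhamel` — the named fact from the Duhamel hypothesis.

## References

* H. Bahouri, J.-Y. Chemin, R. Danchin, *Fourier Analysis and Nonlinear PDE*, Grundlehren 343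
  (2011), Thm. 5.40. [BahouriCheminDanchin2011]
* I. Gallagher, G. Koch, F. Planchon, *Blow-up of critical Besov norms at a potential
  Navier–Stokes singularity*, CMP 343 (2016) = arXiv:1407.4156: §1.2, (4.1), Rem. 4.1, App. B.
  [GKP2016]
* T. Kato, Math. Z. 187 (1984), Thm. 1, §2. [Kato1984]
* P. G. Lemarié-Rieusset, *The Navier–Stokes Problem in the 21st Century* (2016), Thm. 6.1,
  Thm. 7.5 (proof), Thm. 8.7, (8.6), Thm. 8.9. [LemarieRieusset2016]
-/


noncomputable section

open MeasureTheory Set Function Filter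
open _root_.Topology
open scoped SchwartzMap ENNReal NNReal


/-! ## Proofs: tools -/

namespace Literature.Analysis.FluidPDE

section ProofTools


/-- Distributions of fields are homogeneous under real scalars: if `U` is the distribution of
`u₀` then `c • U` is the distribution of `c • u₀` (linearity of `∫ φ • u₀`). [folklore] -/
theorem IsDistributionOf.const_smul {u₀ : EuclideanSpace ℝ (Fin 3) → EuclideanSpace ℝ (Fin 3)}
    {U : 𝓢'(EuclideanSpace ℝ (Fin 3), EuclideanSpace ℂ (Fin 3))} (hU : IsDistributionOf u₀ U)
    (c : ℝ) : IsDistributionOf (c • u₀) ((c : ℂ) • U) := by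
  intro φ
  have hpt : ∀ x, FunctionSpaces.EuclideanSpace.complexify ((c • u₀) x) =
      (c : ℂ) • FunctionSpaces.EuclideanSpace.complexify (u₀ x) := fun x => by
    have h := congrFun (complexify_comp_smul c u₀) x
    simpa only [Function.comp_apply, Pi.smul_apply] using h
  have hfun : (fun x => φ x • FunctionSpaces.EuclideanSpace.complexify ((c • u₀) x)) =
      fun x => (c : ℂ) • (φ x • FunctionSpaces.EuclideanSpace.complexify (u₀ x)) := by
    funext x
    rw [hpt x, smul_comm]
  rw [hfun]
  refine ⟨(hU φ).1.smul (c : ℂ), ?_⟩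
  rw [integral_smul, ← (hU φ).2]
  rfl

/-- The Duhamel term on `(0, t]` only sees the slices on `(0, t)`: fields that agree slice-wise on
`(0, T)` have the same `B(·,·)(t)` for `t ≤ T`. [folklore] -/
theorem kochTataruBilinear_congr_of_eqOn {E : Type*} [NormedAddCommGroup E] [InnerProductSpace ℝ E]
    [FiniteDimensional ℝ E] [MeasurableSpace E] [BorelSpace E] {u u' v v' : ℝ → E → E} {T : ℝ}
    (hu : ∀ s ∈ Ioo 0 T, u s = u' s) (hv : ∀ s ∈ Ioo 0 T, v s = v' s) {t : ℝ} (ht : t ≤ T) :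
    kochTataruBilinear u v t = kochTataruBilinear u' v' t := by
  funext x
  simp only [kochTataruBilinear]
  refine setIntegral_congr_fun measurableSet_Ioo fun s hs => ?_
  have hsT : s ∈ Ioo 0 T := ⟨hs.1, hs.2.trans_le ht⟩
  rw [hu s hsT, hv s hsT]

/-- Slices of a jointly measurable field obeying an `L^p` bound on `(0, T)` are in `L^p`. [folklore] -/
theorem memLp_slice_of_eLpNorm_le {X : Type*} [MeasureSpace X] {F : Type*} [NormedAddCommGroup F]
    [SecondCountableTopology F] [MeasurableSpace F] [BorelSpace F]
    {w : ℝ → X → F} (hwm : Measurable (uncurry w)) {p : ℝ≥0∞} {T : ℝ} {g : ℝ → ℝ}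
    (hw : ∀ t ∈ Ioo 0 T, eLpNorm (w t) p volume ≤ ENNReal.ofReal (g t))
    {t : ℝ} (ht : t ∈ Ioo 0 T) : MemLp (w t) p volume :=
  ⟨(hwm.comp (measurable_const.prodMk measurable_id)).aestronglyMeasurable,
    (hw t ht).trans_lt ENNReal.ofReal_lt_top⟩

/-- `√t · (c · t^{-1/2}) = c` for `t > 0`. [folklore] -/
theorem sqrt_mul_mul_rpow_neg_half {t : ℝ} (ht : 0 < t) (c : ℝ) :
    Real.sqrt t * (c * t ^ (-(1 / 2 : ℝ))) = c := by
  rw [Real.sqrt_eq_rpow, Real.rpow_neg ht.le, mul_left_comm, mul_inv_cancel₀ (Real.rpow_pos_of_pos ht _).ne',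
    mul_one]

/-- Kato's `L^∞` weight in `ℝ≥0∞` form: a pointwise bound `‖w x‖ ≤ c t^{-1/2}` gives
`√t ‖w‖_{L^∞} ≤ c`. [folklore] -/
theorem ofReal_sqrt_mul_eLpNorm_top_le {X : Type*} [MeasurableSpace X] {μ : Measure X}
    {F : Type*} [NormedAddCommGroup F] {w : X → F} {t c : ℝ} (ht : 0 < t)
    (h : ∀ x, ‖w x‖ ≤ c * t ^ (-(1 / 2 : ℝ))) :
    ENNReal.ofReal (Real.sqrt t) * eLpNorm w ∞ μ ≤ ENNReal.ofReal c := by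
  calc ENNReal.ofReal (Real.sqrt t) * eLpNorm w ∞ μ
      ≤ ENNReal.ofReal (Real.sqrt t) * ENNReal.ofReal (c * t ^ (-(1 / 2 : ℝ))) := by
        gcongr; exact eLpNorm_top_le_ofReal_of_norm_le h
    _ = ENNReal.ofReal c := by
        rw [← ENNReal.ofReal_mul (Real.sqrt_nonneg _), sqrt_mul_mul_rpow_neg_half ht]

end ProofTools

end Literature.Analysis.FluidPDE

/-! ## Proofs: the assembly at unit viscosity -/

namespace Literature.Analysis.FluidPDE

section UnitAssembly


/-- **Local Besov mild solutions at unit viscosity, from the Duhamel estimate** (the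
Cannone–Planchon construction; GKP 2016, §1.2 with App. B; Lemarié-Rieusset 2016, Thm. 8.7/8.9):
for `3 < p < ∞`, `1 ≤ q < ∞`, a weakly divergence-free `u₀` with distribution
`U₀ ∈ Ḃ^{-1+3/p}_{p,q}`, and granted the Besov regularity/continuity of Duhamel terms of Kato-class
fields with constant `C₅` (hypothesis `hBES`), there are `T > 0` and a Besov mild solution `(u, U)`
on `[0, T)` with viscosity `1` and `u 0 = u₀`. Construction: the free evolution is small in Kato's
norms on some `(0, T₀)` (`besov_heatExtension_kato_small'`); Kato's fixed point `u` there
(`KatoLp.exists_katoLp_fixedPoint_heatTest`) is the solution on `(0, T₀)` (datum `u₀` at `t = 0`,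
zero elsewhere); `isMildNSSolutionOn_of_kato_fixedPoint'` gives the duality-form mildness;
`U t = e^{tΔ}U₀ - V t` with `V` from `hBES` represents `u t`
(`isDistributionOf_heatExtension_of_eLpNormDistrib_lt_top'`); it is in `Ḃ^{-1+3/p}_{p,q}` and
continuous in `t` by `hBES`, `tendsto_eHomBesovNorm_heatSemigroup_sub`, with the realisation
condition from `tendsto_lowFreqCutoff_of_memLp_of_isDistributionOf` and `MemHomBesov.heatSemigroup`;
Kato's class `K_∞` with `o(t^{-1/2})` at `0⁺` by the localisation clause of the fixed point.
[cite: GKP2016, §1.2 and App. B] -/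
theorem exists_isBesovMildSolutionOn_unit_of_duhamel
    {p q : ℝ≥0∞} [Fact (1 ≤ p)] (hp₃ : 3 < p) (hp : p < ∞) (hq₁ : 1 ≤ q) (hq : q < ∞)
    {C₅ : ℝ} (hC₅ : 0 < C₅)
    (hBES : ∀ ⦃u : ℝ → EuclideanSpace ℝ (Fin 3) → EuclideanSpace ℝ (Fin 3)⦄ ⦃T a b : ℝ⦄,
      Measurable (uncurry u) → 0 < T → 0 ≤ a → 0 ≤ b →
      (∀ t ∈ Ioo 0 T, eLpNorm (u t) p volume ≤
          ENNReal.ofReal (a * t ^ (-((1 - 3 / p.toReal) / 2)))) →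
      (∀ t ∈ Ioo 0 T, ∀ x, ‖u t x‖ ≤ b * t ^ (-(1 / 2 : ℝ))) →
        ∃ V : ℝ → 𝓢'(EuclideanSpace ℝ (Fin 3), EuclideanSpace ℂ (Fin 3)),
          (∀ t ∈ Ioo 0 T, IsDistributionOf (kochTataruBilinear u u t) (V t)) ∧
          (∀ t ∈ Ioo 0 T, FunctionSpaces.eHomBesovNorm (-1 + 3 / p.toReal) p 1 (V t) ≤
              ENNReal.ofReal (C₅ * a * b)) ∧
          ∀ t₀ ∈ Ioo 0 T, Tendsto
            (fun t => FunctionSpaces.eHomBesovNorm (-1 + 3 / p.toReal) p 1 (V t - V t₀))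
            (𝓝[Ioo 0 T] t₀) (𝓝 0))
    {u₀ : EuclideanSpace ℝ (Fin 3) → EuclideanSpace ℝ (Fin 3)}
    {U₀ : 𝓢'(EuclideanSpace ℝ (Fin 3), EuclideanSpace ℂ (Fin 3))}
    (hdiv : IsWeaklyDivFree u₀) (hU₀ : IsDistributionOf u₀ U₀)
    (hB : FunctionSpaces.MemHomBesov (-1 + 3 / p.toReal) p q U₀) :
    ∃ T : ℝ, 0 < T ∧ ∃ (u : ℝ → EuclideanSpace ℝ (Fin 3) → EuclideanSpace ℝ (Fin 3))
      (U : ℝ → 𝓢'(EuclideanSpace ℝ (Fin 3), EuclideanSpace ℂ (Fin 3))),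
      IsBesovMildSolutionOn (-1 + 3 / p.toReal) p q T 1 u U ∧ u 0 = u₀ := by
  -- ### exponents
  have hp3r : (3 : ℝ) < p.toReal := by
    have h := ENNReal.toReal_strict_mono hp.ne hp₃
    simpa using h
  have hσ : 0 < 1 - 3 / p.toReal := by
    have : 3 / p.toReal < 1 := (div_lt_one (by linarith)).2 hp3r
    linarith
  have hidx : -(1 - 3 / p.toReal) = -1 + 3 / p.toReal := by ring
  have hq0 : q ≠ 0 := (zero_lt_one.trans_le hq₁).ne'
  -- ### the constant of Kato's fixed point
  obtain ⟨c, hc, hFP⟩ := KatoLp.exists_katoLp_fixedPoint_heatTest (E := EuclideanSpace ℝ (Fin 3))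
    finrank_euclideanSpace_fin hp₃ hp
  set a₀ : ℝ := 1 / (2 * c) with ha₀
  have ha₀pos : 0 < a₀ := by positivity
  have hca₀ : c * a₀ ≤ 1 := by
    rw [ha₀, mul_one_div, div_le_one (by positivity)]; linarith
  -- ### a strongly measurable representative of the datum
  have hmeas₀ : AEStronglyMeasurable u₀ volume := hU₀.aestronglyMeasurable
  set v₀ : EuclideanSpace ℝ (Fin 3) → EuclideanSpace ℝ (Fin 3) := hmeas₀.mk u₀ with hv₀def
  have hv₀m : StronglyMeasurable v₀ := hmeas₀.stronglyMeasurable_mk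
  have hae : u₀ =ᵐ[volume] v₀ := hmeas₀.ae_eq_mk
  have hheat : ∀ {t : ℝ}, 0 < t → heatTest 1 v₀ t = UnboundedOperators.heatExtension u₀ t := by
    intro t ht
    rw [heatTest_of_pos one_pos ht, one_mul]
    exact heatExtension_congr_ae hae.symm t
  -- ### smallness windows of the free evolution
  have hwin : ∀ {ε : ℝ}, 0 < ε → ∃ T₀ : ℝ, 0 < T₀ ∧
      (∀ t ∈ Ioo 0 T₀, eLpNorm (heatTest 1 v₀ t) p volume ≤
          ENNReal.ofReal (ε * t ^ (-((1 - 3 / p.toReal) / 2)))) ∧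
        ∀ t ∈ Ioo 0 T₀, ∀ x, ‖heatTest 1 v₀ t x‖ ≤ ε * t ^ (-(1 / 2 : ℝ)) := by
    intro ε hε
    obtain ⟨T₀, hT₀, hT⟩ := besov_heatExtension_kato_small' hp₃ hp hq₁ hq hU₀ hB hε
    exact ⟨T₀, hT₀, fun t ht => by rw [hheat ht.1]; exact (hT t ht).1,
      fun t ht x => by rw [hheat ht.1]; exact (hT t ht).2 x⟩
  obtain ⟨T₀, hT₀, hUp, hUi⟩ := hwin ha₀pos
  -- ### the fixed point
  obtain ⟨u, hum, hfix, hLp, hLi, hloc⟩ := hFP hv₀m hT₀ ha₀pos ha₀pos.le hca₀ hUp hUi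
  -- the fixed point identity as an identity of slices
  have hfixF : ∀ t ∈ Ioo 0 T₀,
      u t = UnboundedOperators.heatExtension u₀ t - kochTataruBilinear u u t := by
    intro t ht
    funext x
    rw [Pi.sub_apply, ← hheat ht.1]
    exact hfix t ht x
  have hBu : ∀ t ∈ Ioo 0 T₀,
      kochTataruBilinear u u t = UnboundedOperators.heatExtension u₀ t - u t := by
    intro t ht
    rw [hfixF t ht]
    abel
  -- localisation of both Kato bounds near `t = 0`
  have hsmall : ∀ {a₁ : ℝ}, 0 < a₁ → a₁ ≤ a₀ → ∃ t₁ : ℝ, 0 < t₁ ∧ t₁ ≤ T₀ ∧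
      (∀ t ∈ Ioo 0 t₁, eLpNorm (u t) p volume ≤
          ENNReal.ofReal (2 * a₁ * t ^ (-((1 - 3 / p.toReal) / 2)))) ∧
        ∀ t ∈ Ioo 0 t₁, ∀ x, ‖u t x‖ ≤ 2 * (a₁ + a₁) * t ^ (-(1 / 2 : ℝ)) := by
    intro a₁ ha₁ ha₁₀
    obtain ⟨t₁, ht₁, hUp₁, hUi₁⟩ := hwin ha₁
    have hca₁ : c * a₁ ≤ 1 := (mul_le_mul_of_nonneg_left ha₁₀ hc.le).trans hca₀
    refine ⟨min t₁ T₀, lt_min ht₁ hT₀, min_le_right _ _, ?_⟩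
    exact hloc (min_le_right _ _) ha₁ ha₁.le hca₁
      (fun t ht => hUp₁ t ⟨ht.1, ht.2.trans_le (min_le_left _ _)⟩)
      (fun t ht x => hUi₁ t ⟨ht.1, ht.2.trans_le (min_le_left _ _)⟩ x)
  -- ### `L^p` slices
  have huLp : ∀ t ∈ Ioo 0 T₀, MemLp (u t) p volume := fun t ht =>
    memLp_slice_of_eLpNorm_le hum hLp ht
  have hUm : Measurable (uncurry (heatTest 1 v₀)) := measurable_uncurry_heatTest hv₀m 1
  have hheatLp : ∀ t ∈ Ioo 0 T₀, MemLp (UnboundedOperators.heatExtension u₀ t) p volume := by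
    intro t ht
    rw [← hheat ht.1]
    exact memLp_slice_of_eLpNorm_le hUm hUp ht
  have hBLp : ∀ t ∈ Ioo 0 T₀, MemLp (kochTataruBilinear u u t) p volume := by
    intro t ht
    rw [hBu t ht]
    exact (hheatLp t ht).sub (huLp t ht)
  -- ### finiteness of `‖e^{tΔ}U₀‖_{L^p}` (Kato–Besov) and the free evolution as a distribution
  have hfinD : ∀ {t : ℝ}, 0 < t →
      FunctionSpaces.eLpNormDistrib p (TemperedDistribution.heatSemigroup t U₀) < ∞ := by
    intro t ht
    obtain ⟨CK, hCK⟩ :=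
      FunctionSpaces.exists_eLpNormDistrib_heatSemigroup_le_rpow_mul_eHomBesovNorm
        (E := EuclideanSpace ℝ (Fin 3)) (F := EuclideanSpace ℂ (Fin 3)) p hσ
    have h := hCK t ht U₀ hB.2
    rw [hidx] at h
    refine h.trans_lt (ENNReal.mul_lt_top (ENNReal.mul_lt_top ENNReal.coe_lt_top
      ENNReal.ofReal_lt_top) ?_)
    exact (eHomBesovNorm_exponent_antitone _ p hq0 le_top U₀).trans_lt hB.1
  have hheatD : ∀ {t : ℝ}, 0 < t → IsDistributionOf (UnboundedOperators.heatExtension u₀ t)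
      (TemperedDistribution.heatSemigroup t U₀) := fun ht =>
    (isDistributionOf_heatExtension_of_eLpNormDistrib_lt_top' hU₀ ht (hfinD ht)).1
  -- ### the Duhamel term in Besov (hypothesis)
  have h2a₀ : 0 ≤ 2 * a₀ := by positivity
  have h4a₀ : 0 ≤ 2 * (a₀ + a₀) := by positivity
  obtain ⟨V, hVd, hVb, hVc⟩ := hBES hum hT₀ h2a₀ h4a₀ hLp hLi
  -- ### the solution field and its distributions
  set w : ℝ → EuclideanSpace ℝ (Fin 3) → EuclideanSpace ℝ (Fin 3) := fun t =>
    if t ∈ Ioo 0 T₀ then u t else if t = 0 then u₀ else 0 with hwdef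
  have hw0 : w 0 = u₀ := by
    simp only [hwdef, mem_Ioo, lt_self_iff_false, false_and, if_false, if_true]
  have hwt : ∀ {t : ℝ}, t ∈ Ioo 0 T₀ → w t = u t := fun ht => by
    simp only [hwdef, ht, if_true]
  have hwT : ∀ {t : ℝ}, T₀ ≤ t → w t = 0 := fun {t} ht => by
    have h1 : t ∉ Ioo 0 T₀ := fun h => (not_le.2 h.2) ht
    have h2 : t ≠ 0 := (hT₀.trans_le ht).ne'
    simp only [hwdef, h1, h2, if_false]
  set U : ℝ → 𝓢'(EuclideanSpace ℝ (Fin 3), EuclideanSpace ℂ (Fin 3)) := fun t =>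
    if t ∈ Ioo 0 T₀ then TemperedDistribution.heatSemigroup t U₀ - V t else U₀ with hUdef
  have hU0 : U 0 = U₀ := by
    simp only [hUdef, mem_Ioo, lt_self_iff_false, false_and, if_false]
  have hUt : ∀ {t : ℝ}, t ∈ Ioo 0 T₀ → U t = TemperedDistribution.heatSemigroup t U₀ - V t :=
    fun ht => by simp only [hUdef, ht, if_true]
  -- Kato bounds of `w` for all `t > 0`
  have hwLp : ∀ t : ℝ, 0 < t → eLpNorm (w t) p volume ≤
      ENNReal.ofReal (2 * a₀ * t ^ (-((1 - 3 / p.toReal) / 2))) := by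
    intro t ht
    rcases lt_or_ge t T₀ with h | h
    · rw [hwt ⟨ht, h⟩]; exact hLp t ⟨ht, h⟩
    · rw [hwT h]; simp
  have hwLi : ∀ t : ℝ, 0 < t → ∀ x, ‖w t x‖ ≤ 2 * (a₀ + a₀) * t ^ (-(1 / 2 : ℝ)) := by
    intro t ht x
    rcases lt_or_ge t T₀ with h | h
    · rw [hwt ⟨ht, h⟩]; exact hLi t ⟨ht, h⟩ x
    · rw [hwT h]
      simp only [Pi.zero_apply, norm_zero]
      positivity
  -- measurability of `w` on `(0, ∞) × ℝ³` and on `(0, T₀) × ℝ³`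
  have hcut : Measurable (uncurry fun t x =>
      if t ∈ Ioo 0 T₀ then u t x else (0 : EuclideanSpace ℝ (Fin 3))) := by
    have hset : MeasurableSet {q : ℝ × EuclideanSpace ℝ (Fin 3) | q.1 ∈ Ioo 0 T₀} :=
      measurableSet_Ioo.preimage measurable_fst
    exact Measurable.ite hset hum measurable_const
  have hwae : ∀ S : Set ℝ, S ⊆ Ioi 0 → MeasurableSet S →
      AEStronglyMeasurable (uncurry w)
        ((volume : Measure (ℝ × EuclideanSpace ℝ (Fin 3))).restrict (S ×ˢ univ)) := by
    intro S hS hSm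
    refine (hcut.aestronglyMeasurable).congr ?_
    refine (ae_restrict_mem (hSm.prod MeasurableSet.univ)).mono fun z hz => ?_
    have hz1 : 0 < z.1 := hS hz.1
    rcases lt_or_ge z.1 T₀ with h | h
    · have hz' : z.1 ∈ Ioo 0 T₀ := ⟨hz1, h⟩
      simp only [uncurry, hwdef, hz', if_true]
    · have h1 : z.1 ∉ Ioo 0 T₀ := fun h' => (not_le.2 h'.2) h
      have h2 : z.1 ≠ 0 := hz1.ne'
      simp only [uncurry, hwdef, h1, h2, if_false, Pi.zero_apply]
  -- ### mildness
  have hwslice : ∀ t : ℝ, 0 < t → AEStronglyMeasurable (w t) volume := by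
    intro t ht
    rcases lt_or_ge t T₀ with h | h
    · rw [hwt ⟨ht, h⟩]
      exact (hum.comp (measurable_const.prodMk measurable_id)).aestronglyMeasurable
    · rw [hwT h]
      exact aestronglyMeasurable_const
  have hmild : IsMildNSSolutionOn (Ico 0 T₀) 1 0 u₀ w := by
    refine isMildNSSolutionOn_of_kato_fixedPoint' hU₀ hdiv hp₃ hp hw0
      (hwae (Ioi 0) Subset.rfl measurableSet_Ioi) hwslice hwLp hwLi hheatLp fun t ht => ?_
    rw [kochTataruBilinear_congr_of_eqOn (fun s hs => hwt hs) (fun s hs => hwt hs) ht.2.le, hwt ht,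
      hfixF t ht]
    exact Eventually.of_forall fun x => rfl
  -- ### distributions of the slices
  have hdist : ∀ t ∈ Ico 0 T₀, IsDistributionOf (w t) (U t) := by
    intro t ht
    rcases ht.1.eq_or_lt with h | hpos
    · rw [← h, hw0, hU0]; exact hU₀
    · have ht' : t ∈ Ioo 0 T₀ := ⟨hpos, ht.2⟩
      rw [hwt ht', hUt ht', hfixF t ht']
      exact (hheatD hpos).sub (hVd t ht')
  -- ### Besov membership of the slices
  have hVq : ∀ {t : ℝ}, t ∈ Ioo 0 T₀ →
      FunctionSpaces.eHomBesovNorm (-1 + 3 / p.toReal) p q (V t) ≤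
        ENNReal.ofReal (C₅ * (2 * a₀) * (2 * (a₀ + a₀))) :=
    fun {t} ht => (eHomBesovNorm_exponent_antitone _ p one_ne_zero hq₁ (V t)).trans (hVb t ht)
  have hVreal : ∀ {t : ℝ}, t ∈ Ioo 0 T₀ →
      Tendsto (fun j : ℤ => FunctionSpaces.lowFreqCutoff j (V t)) atBot (𝓝 0) :=
    fun {t} ht => tendsto_lowFreqCutoff_of_memLp_of_isDistributionOf hp (hBLp t ht) (hVd t ht)
  have hVmem : ∀ {t : ℝ}, t ∈ Ioo 0 T₀ → FunctionSpaces.MemHomBesov (-1 + 3 / p.toReal) p q (V t) :=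
    fun ht => ⟨(hVq ht).trans_lt ENNReal.ofReal_lt_top, hVreal ht⟩
  have hAmem : ∀ {t : ℝ}, 0 ≤ t →
      FunctionSpaces.MemHomBesov (-1 + 3 / p.toReal) p q (TemperedDistribution.heatSemigroup t U₀) :=
    fun ht => hB.heatSemigroup ht
  have hsubmem : ∀ {A B : 𝓢'(EuclideanSpace ℝ (Fin 3), EuclideanSpace ℂ (Fin 3))},
      FunctionSpaces.MemHomBesov (-1 + 3 / p.toReal) p q A →
      FunctionSpaces.MemHomBesov (-1 + 3 / p.toReal) p q B →
      FunctionSpaces.MemHomBesov (-1 + 3 / p.toReal) p q (A - B) := by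
    intro A B hA hB'
    refine ⟨?_, ?_⟩
    · calc FunctionSpaces.eHomBesovNorm (-1 + 3 / p.toReal) p q (A - B)
          ≤ FunctionSpaces.eHomBesovNorm (-1 + 3 / p.toReal) p q A +
              FunctionSpaces.eHomBesovNorm (-1 + 3 / p.toReal) p q (-B) := by
            rw [sub_eq_add_neg]; exact eHomBesovNorm_add_le _ p hq₁ A (-B)
        _ < ∞ := by
            rw [eHomBesovNorm_neg]
            exact ENNReal.add_lt_top.2 ⟨hA.1, hB'.1⟩
    · have h := hA.2.sub hB'.2
      simpa only [map_sub, sub_zero] using h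
  have hUmem : ∀ t ∈ Ico 0 T₀, FunctionSpaces.MemHomBesov (-1 + 3 / p.toReal) p q (U t) := by
    intro t ht
    rcases ht.1.eq_or_lt with h | hpos
    · rw [← h, hU0]; exact hB
    · have ht' : t ∈ Ioo 0 T₀ := ⟨hpos, ht.2⟩
      rw [hUt ht']
      exact hsubmem (hAmem hpos.le) (hVmem ht')
  -- ### continuity in `Ḃ^{-1+3/p}_{p,q}` at positive times
  have hcont_pos : ∀ t₀ ∈ Ioo 0 T₀, Tendsto
      (fun t => FunctionSpaces.eHomBesovNorm (-1 + 3 / p.toReal) p q (U t - U t₀))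
      (𝓝[Ico 0 T₀] t₀) (𝓝 0) := by
    intro t₀ ht₀
    have hfilter : 𝓝[Ico 0 T₀] t₀ = 𝓝[Ioo 0 T₀] t₀ := by
      have hmem : Ioi (0 : ℝ) ∈ 𝓝[Ico 0 T₀] t₀ := mem_nhdsWithin_of_mem_nhds (Ioi_mem_nhds ht₀.1)
      rw [← nhdsWithin_inter_of_mem hmem]
      congr 1
      ext t
      simp only [mem_inter_iff, mem_Ioi, mem_Ico, mem_Ioo]
      constructor
      · rintro ⟨h1, -, h3⟩; exact ⟨h1, h3⟩
      · rintro ⟨h1, h3⟩; exact ⟨h1, h1.le, h3⟩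
    rw [hfilter]
    have hA : Tendsto (fun t => FunctionSpaces.eHomBesovNorm (-1 + 3 / p.toReal) p q
        (TemperedDistribution.heatSemigroup t U₀ - TemperedDistribution.heatSemigroup t₀ U₀))
        (𝓝[Ioo 0 T₀] t₀) (𝓝 0) :=
      (tendsto_eHomBesovNorm_heatSemigroup_sub hp hq₁ hq hB ht₀.1.le).mono_left
        (nhdsWithin_mono _ fun t ht => (le_of_lt ht.1 : (0 : ℝ) ≤ t))
    have hV : Tendsto (fun t => FunctionSpaces.eHomBesovNorm (-1 + 3 / p.toReal) p q (V t - V t₀))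
        (𝓝[Ioo 0 T₀] t₀) (𝓝 0) :=
      tendsto_of_tendsto_of_tendsto_of_le_of_le tendsto_const_nhds (hVc t₀ ht₀) (fun _ => zero_le)
        fun t => eHomBesovNorm_exponent_antitone _ p one_ne_zero hq₁ _
    have hsum := hA.add hV
    rw [add_zero] at hsum
    refine tendsto_of_tendsto_of_tendsto_of_le_of_le' tendsto_const_nhds hsum
      (Eventually.of_forall fun _ => zero_le) ?_
    filter_upwards [self_mem_nhdsWithin] with t ht
    rw [hUt ht, hUt ht₀,
      show TemperedDistribution.heatSemigroup t U₀ - V t - (TemperedDistribution.heatSemigroup t₀ U₀ - V t₀) =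
        (TemperedDistribution.heatSemigroup t U₀ - TemperedDistribution.heatSemigroup t₀ U₀) + (-(V t - V t₀)) by
          abel]
    calc FunctionSpaces.eHomBesovNorm (-1 + 3 / p.toReal) p q
          ((TemperedDistribution.heatSemigroup t U₀ - TemperedDistribution.heatSemigroup t₀ U₀) + (-(V t - V t₀)))
        ≤ FunctionSpaces.eHomBesovNorm (-1 + 3 / p.toReal) p q
            (TemperedDistribution.heatSemigroup t U₀ - TemperedDistribution.heatSemigroup t₀ U₀) +
          FunctionSpaces.eHomBesovNorm (-1 + 3 / p.toReal) p q (-(V t - V t₀)) :=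
          eHomBesovNorm_add_le _ p hq₁ _ _
      _ = _ := by rw [eHomBesovNorm_neg]
  -- ### continuity in `Ḃ^{-1+3/p}_{p,q}` at `t = 0`
  have hH0 : TemperedDistribution.heatSemigroup 0 U₀ = U₀ := by
    rw [TemperedDistribution.heatSemigroup_zero]; rfl
  have hV0 : Tendsto (fun t => FunctionSpaces.eHomBesovNorm (-1 + 3 / p.toReal) p q (V t))
      (𝓝[Ioo 0 T₀] 0) (𝓝 0) := by
    rw [ENNReal.tendsto_nhds_zero]
    intro ε hε
    by_cases hεtop : ε = ⊤
    · rw [hεtop]; exact Eventually.of_forall fun t => le_top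
    have hεr : 0 < ε.toReal := ENNReal.toReal_pos hε.ne' hεtop
    set a₁ : ℝ := min a₀ (Real.sqrt (ε.toReal / (8 * C₅))) with ha₁def
    have ha₁ : 0 < a₁ := lt_min ha₀pos (Real.sqrt_pos.2 (by positivity))
    obtain ⟨t₁, ht₁, ht₁T, hLp₁, hLi₁⟩ := hsmall ha₁ (min_le_left _ _)
    obtain ⟨V', hVd', hVb', -⟩ := hBES hum ht₁ (by positivity : (0 : ℝ) ≤ 2 * a₁)
      (by positivity : (0 : ℝ) ≤ 2 * (a₁ + a₁)) hLp₁ hLi₁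
    have hkey : C₅ * (2 * a₁) * (2 * (a₁ + a₁)) ≤ ε.toReal := by
      have h1 : a₁ ≤ Real.sqrt (ε.toReal / (8 * C₅)) := min_le_right _ _
      have h2 : a₁ ^ 2 ≤ ε.toReal / (8 * C₅) := by
        calc a₁ ^ 2 ≤ (Real.sqrt (ε.toReal / (8 * C₅))) ^ 2 := by gcongr
          _ = ε.toReal / (8 * C₅) := Real.sq_sqrt (by positivity)
      calc C₅ * (2 * a₁) * (2 * (a₁ + a₁)) = 8 * C₅ * a₁ ^ 2 := by ring
        _ ≤ 8 * C₅ * (ε.toReal / (8 * C₅)) := by gcongr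
        _ = ε.toReal := by field_simp
    filter_upwards [mem_nhdsWithin_of_mem_nhds (Iio_mem_nhds ht₁), self_mem_nhdsWithin] with t ht1 ht2
    have ht' : t ∈ Ioo 0 t₁ := ⟨ht2.1, ht1⟩
    have hVV : V' t = V t := (hVd' t ht').unique (hVd t ⟨ht2.1, ht1.trans_le ht₁T⟩)
    calc FunctionSpaces.eHomBesovNorm (-1 + 3 / p.toReal) p q (V t)
        ≤ FunctionSpaces.eHomBesovNorm (-1 + 3 / p.toReal) p 1 (V t) :=
          eHomBesovNorm_exponent_antitone _ p one_ne_zero hq₁ _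
      _ ≤ ENNReal.ofReal (C₅ * (2 * a₁) * (2 * (a₁ + a₁))) := by rw [← hVV]; exact hVb' t ht'
      _ ≤ ε := by
          rw [← ENNReal.ofReal_toReal hεtop]
          exact ENNReal.ofReal_le_ofReal hkey
  have hcont_zero : Tendsto
      (fun t => FunctionSpaces.eHomBesovNorm (-1 + 3 / p.toReal) p q (U t - U 0))
      (𝓝[Ico 0 T₀] 0) (𝓝 0) := by
    rw [← Ioo_insert_left hT₀, nhdsWithin_insert, tendsto_sup]
    constructor
    · have h0 : FunctionSpaces.eHomBesovNorm (-1 + 3 / p.toReal) p q (U 0 - U 0) = 0 := by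
        rw [sub_self, FunctionSpaces.eHomBesovNorm_zero]
      have h := tendsto_pure_nhds
        (fun t => FunctionSpaces.eHomBesovNorm (-1 + 3 / p.toReal) p q (U t - U 0)) 0
      rwa [h0] at h
    · have hA : Tendsto (fun t => FunctionSpaces.eHomBesovNorm (-1 + 3 / p.toReal) p q
          (TemperedDistribution.heatSemigroup t U₀ - TemperedDistribution.heatSemigroup 0 U₀))
          (𝓝[Ioo 0 T₀] 0) (𝓝 0) :=
        (tendsto_eHomBesovNorm_heatSemigroup_sub hp hq₁ hq hB le_rfl).mono_left
          (nhdsWithin_mono _ fun t ht => (le_of_lt ht.1 : (0 : ℝ) ≤ t))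
      have hsum := hA.add hV0
      rw [add_zero] at hsum
      refine tendsto_of_tendsto_of_tendsto_of_le_of_le' tendsto_const_nhds hsum
        (Eventually.of_forall fun _ => zero_le) ?_
      filter_upwards [self_mem_nhdsWithin] with t ht
      rw [hUt ht, hU0,
        show TemperedDistribution.heatSemigroup t U₀ - V t - U₀ =
          (TemperedDistribution.heatSemigroup t U₀ - TemperedDistribution.heatSemigroup 0 U₀) + (-(V t)) by
            rw [hH0]; abel]
      calc FunctionSpaces.eHomBesovNorm (-1 + 3 / p.toReal) p q
            ((TemperedDistribution.heatSemigroup t U₀ - TemperedDistribution.heatSemigroup 0 U₀) + (-(V t)))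
          ≤ FunctionSpaces.eHomBesovNorm (-1 + 3 / p.toReal) p q
              (TemperedDistribution.heatSemigroup t U₀ - TemperedDistribution.heatSemigroup 0 U₀) +
            FunctionSpaces.eHomBesovNorm (-1 + 3 / p.toReal) p q (-(V t)) :=
            eHomBesovNorm_add_le _ p hq₁ _ _
        _ = _ := by rw [eHomBesovNorm_neg]
  -- ### Kato's class `K_∞`
  have hkato : MemKatoClassOn T₀ w := by
    refine ⟨fun t ht => ?_, ?_⟩
    · refine lt_of_le_of_lt (iSup₂_le fun τ hτ => ?_) (ENNReal.ofReal_lt_top (r := 2 * (a₀ + a₀)))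
      have hτT : τ ∈ Ioo 0 T₀ := ⟨hτ.1, hτ.2.trans ht⟩
      rw [hwt hτT]
      exact ofReal_sqrt_mul_eLpNorm_top_le hτ.1 (hLi τ hτT)
    · rw [ENNReal.tendsto_nhds_zero]
      intro ε hε
      by_cases hεtop : ε = ⊤
      · rw [hεtop]; exact Eventually.of_forall fun t => le_top
      have hεr : 0 < ε.toReal := ENNReal.toReal_pos hε.ne' hεtop
      set a₁ : ℝ := min a₀ (ε.toReal / 4) with ha₁def
      have ha₁ : 0 < a₁ := lt_min ha₀pos (by positivity)
      obtain ⟨t₁, ht₁, ht₁T, -, hLi₁⟩ := hsmall ha₁ (min_le_left _ _)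
      filter_upwards [Ioo_mem_nhdsGT ht₁] with t ht
      have htT : t ∈ Ioo 0 T₀ := ⟨ht.1, ht.2.trans_le ht₁T⟩
      rw [hwt htT]
      calc ENNReal.ofReal (Real.sqrt t) * eLpNorm (u t) ∞ volume
          ≤ ENNReal.ofReal (2 * (a₁ + a₁)) := ofReal_sqrt_mul_eLpNorm_top_le ht.1 (hLi₁ t ht)
        _ ≤ ε := by
            rw [← ENNReal.ofReal_toReal hεtop]
            apply ENNReal.ofReal_le_ofReal
            have : a₁ ≤ ε.toReal / 4 := min_le_right _ _
            linarith
  -- ### assembly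
  refine ⟨T₀, hT₀, w, U, ⟨?_, hwae (Ioo 0 T₀) (fun t ht => ht.1) measurableSet_Ioo, hdist,
    ⟨hUmem, fun t₀ ht₀ => ?_⟩, hkato⟩, hw0⟩
  · rw [hw0]; exact hmild
  · rcases ht₀.1.eq_or_lt with h | hpos
    · rw [← h]; exact hcont_zero
    · exact hcont_pos t₀ ⟨hpos, ht₀.2⟩

end UnitAssembly

end Literature.Analysis.FluidPDE

/-! ## Proofs: viscosity scaling and the reduction -/

namespace Literature.Analysis.FluidPDE

section Scaling


/-- The Kato weight under the viscosity scaling: `√t ‖a w(a t)‖_∞ = √a · (√(at) ‖w(at)‖_∞)` for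
`a > 0`. [folklore] -/
theorem ofReal_sqrt_mul_eLpNorm_timeRescale {w : ℝ → EuclideanSpace ℝ (Fin 3) → EuclideanSpace ℝ (Fin 3)}
    {a : ℝ} (ha : 0 < a) (t : ℝ) :
    ENNReal.ofReal (Real.sqrt t) * eLpNorm (FluidPDE.timeRescale a a w t) ∞ volume =
      ENNReal.ofReal (Real.sqrt a) *
        (ENNReal.ofReal (Real.sqrt (a * t)) * eLpNorm (w (a * t)) ∞ volume) := by
  have hslice : FluidPDE.timeRescale a a w t = a • w (a * t) := by
    funext x; simp [timeRescale_apply]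
  have hsq : ENNReal.ofReal (Real.sqrt a) * ENNReal.ofReal (Real.sqrt a) = ENNReal.ofReal a := by
    rw [← ENNReal.ofReal_mul (Real.sqrt_nonneg _), Real.mul_self_sqrt ha.le]
  rw [hslice, eLpNorm_const_smul, Real.enorm_eq_ofReal ha.le, Real.sqrt_mul ha.le,
    ENNReal.ofReal_mul (Real.sqrt_nonneg _), ← hsq]
  ring

/-- **Kato's class `K_∞` under the viscosity scaling** `u(t) = a w(a t)`, `a > 0`: lifespan
`T ↦ T/a`, the weight picks up the constant `√a`. [folklore] -/
theorem MemKatoClassOn.timeRescale {T : ℝ} {w : ℝ → EuclideanSpace ℝ (Fin 3) → EuclideanSpace ℝ (Fin 3)}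
    (h : MemKatoClassOn T w) {a : ℝ}
    (ha : 0 < a) : MemKatoClassOn (T / a) (FluidPDE.timeRescale a a w) := by
  refine ⟨fun t ht => ?_, ?_⟩
  · have hat : a * t < T := by rw [mul_comm]; exact (lt_div_iff₀ ha).1 ht
    have hfin := h.1 (a * t) hat
    have hle : (⨆ τ ∈ Ioo 0 t, ENNReal.ofReal (Real.sqrt τ) *
        eLpNorm (FluidPDE.timeRescale a a w τ) ∞ volume) ≤
        ENNReal.ofReal (Real.sqrt a) *
          ⨆ τ ∈ Ioo 0 (a * t), ENNReal.ofReal (Real.sqrt τ) * eLpNorm (w τ) ∞ volume := by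
      refine iSup₂_le fun τ hτ => ?_
      rw [ofReal_sqrt_mul_eLpNorm_timeRescale ha τ]
      gcongr
      exact le_iSup₂ (f := fun (τ' : ℝ) (_ : τ' ∈ Ioo 0 (a * t)) =>
        ENNReal.ofReal (Real.sqrt τ') * eLpNorm (w τ') ∞ volume) (a * τ)
          ⟨mul_pos ha hτ.1, mul_lt_mul_of_pos_left hτ.2 ha⟩
    exact hle.trans_lt (ENNReal.mul_lt_top ENNReal.ofReal_lt_top hfin)
  · have hmaps : MapsTo (fun t => a * t) (Ioi (0 : ℝ)) (Ioi 0) := fun t ht => mul_pos ha ht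
    have hmap : Tendsto (fun t => a * t) (𝓝[>] (0 : ℝ)) (𝓝[>] 0) := by
      have h' := (continuous_const_mul a).continuousWithinAt.tendsto_nhdsWithin (x := (0 : ℝ)) hmaps
      rwa [mul_zero] at h'
    have hlim := ENNReal.Tendsto.const_mul (h.2.comp hmap) (a := ENNReal.ofReal (Real.sqrt a))
      (Or.inr ENNReal.ofReal_ne_top)
    rw [mul_zero] at hlim
    refine hlim.congr' ?_
    filter_upwards [self_mem_nhdsWithin] with t ht
    exact (ofReal_sqrt_mul_eLpNorm_timeRescale ha t).symm

/-- **Viscosity scaling of Besov mild solutions**: if `(w, W)` is a Besov mild solution on `[0, T)`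
with viscosity `1`, then `u(t, x) = ν w(νt, x)`, `U(t) = ν W(νt)` is one on `[0, T/ν)` with
viscosity `ν > 0` (mildness by `IsMildNSSolutionOn.timeRescale`; the Besov norms scale by the
constant `ν`, `eHomBesovNorm_smul`; Kato's weight picks up `√ν`). [folklore] -/
theorem IsBesovMildSolutionOn.timeRescale_of_unit {s : ℝ} {p q : ℝ≥0∞} [Fact (1 ≤ p)] {T : ℝ}
    {w : ℝ → EuclideanSpace ℝ (Fin 3) → EuclideanSpace ℝ (Fin 3)}
    {W : ℝ → 𝓢'(EuclideanSpace ℝ (Fin 3), EuclideanSpace ℂ (Fin 3))}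
    (h : IsBesovMildSolutionOn s p q T 1 w W) {ν : ℝ}
    (hν : 0 < ν) :
    IsBesovMildSolutionOn s p q (T / ν) ν (FluidPDE.timeRescale ν ν w) fun t => (ν : ℂ) • W (ν * t) := by
  have hmaps : MapsTo (fun t => ν * t) (Ico 0 (T / ν)) (Ico 0 T) := fun t ht =>
    ⟨mul_nonneg hν.le ht.1, by show ν * t < T; rw [mul_comm]; exact (lt_div_iff₀ hν).1 ht.2⟩
  have hslice : ∀ t, FluidPDE.timeRescale ν ν w t = ν • w (ν * t) := fun t => by
    funext x; simp [timeRescale_apply]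
  have hν' : (ν : ℂ) ≠ 0 := by exact_mod_cast hν.ne'
  refine ⟨?_, ?_, fun t ht => ?_, ⟨fun t ht => ?_, fun t₀ ht₀ => ?_⟩, h.memKatoClassOn.timeRescale hν⟩
  · have hm := h.mild.timeRescale hν hmaps
    have hf : FluidPDE.timeRescale ν (ν ^ 2)
        (0 : ℝ → EuclideanSpace ℝ (Fin 3) → EuclideanSpace ℝ (Fin 3)) = 0 := by
      funext t x; simp [timeRescale_apply]
    have h0 : ν • w 0 = FluidPDE.timeRescale ν ν w 0 := by
      rw [hslice 0, mul_zero]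
    rwa [mul_one, hf, h0] at hm
  · have h' := h.aestronglyMeasurable
    rw [show T = ν * (T / ν) by field_simp] at h'
    exact aestronglyMeasurable_uncurry_timeRescale_Ioo hν h' ν
  · rw [hslice t]
    exact (h.isDistributionOf (ν * t) (hmaps ht)).const_smul ν
  · exact memHomBesov_smul _ (h.continuousInHomBesovOn.1 (ν * t) (hmaps ht))
  · have hmap : Tendsto (fun t => ν * t) (𝓝[Ico 0 (T / ν)] t₀) (𝓝[Ico 0 T] (ν * t₀)) :=
      (continuous_const_mul ν).continuousWithinAt.tendsto_nhdsWithin hmaps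
    have hlim := (h.continuousInHomBesovOn.2 (ν * t₀) (hmaps ht₀)).comp hmap
    have heq : (fun t => FunctionSpaces.eHomBesovNorm s p q ((ν : ℂ) • W (ν * t) - (ν : ℂ) • W (ν * t₀))) =
        fun t => ‖(ν : ℂ)‖ₑ * FunctionSpaces.eHomBesovNorm s p q (W (ν * t) - W (ν * t₀)) := by
      funext t; rw [← smul_sub, eHomBesovNorm_smul s p q hν']
    show Tendsto (fun t => FunctionSpaces.eHomBesovNorm s p q ((ν : ℂ) • W (ν * t) - (ν : ℂ) • W (ν * t₀)))
      (𝓝[Ico 0 (T / ν)] t₀) (𝓝 0)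
    rw [heq, ← mul_zero (‖(ν : ℂ)‖ₑ)]
    exact ENNReal.Tendsto.const_mul hlim (Or.inr enorm_ne_top)

/-- **`exists_isBesovMildSolutionOn` from the Duhamel estimate** (BCD Thm. 5.40 / GKP 2016,
§1.2, in the tree's rendering): granted, for every `3 < p < ∞`, the Besov regularity and time
continuity in `Ḃ^{-1+3/p}_{p,1}` of the Duhamel terms `B(u,u)(t)` of Kato-class fields `u`
(GKP 2016, App. B), the named fact holds. For viscosity `ν > 0` apply the unit-viscosity
construction `exists_isBesovMildSolutionOn_unit_of_duhamel` to the datum `ν⁻¹u₀` (still weakly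
divergence free, with distribution `ν⁻¹U₀ ∈ Ḃ^{-1+3/p}_{p,q}`) and rescale by
`IsBesovMildSolutionOn.timeRescale_of_unit`; `u(0) = ν · ν⁻¹u₀ = u₀`. [cite: GKP2016, §1.2 and App. B] -/
theorem exists_isBesovMildSolutionOn_of_duhamel
    (h5 : ∀ ⦃p : ℝ≥0∞⦄ [Fact (1 ≤ p)], 3 < p → p < ∞ →
      ∃ C : ℝ, 0 < C ∧ ∀ ⦃u : ℝ → EuclideanSpace ℝ (Fin 3) → EuclideanSpace ℝ (Fin 3)⦄ ⦃T a b : ℝ⦄,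
        Measurable (uncurry u) →
        0 < T → 0 ≤ a → 0 ≤ b →
        (∀ t ∈ Ioo 0 T, eLpNorm (u t) p volume ≤
            ENNReal.ofReal (a * t ^ (-((1 - 3 / p.toReal) / 2)))) →
        (∀ t ∈ Ioo 0 T, ∀ x, ‖u t x‖ ≤ b * t ^ (-(1 / 2 : ℝ))) →
          ∃ V : ℝ → 𝓢'(EuclideanSpace ℝ (Fin 3), EuclideanSpace ℂ (Fin 3)),
            (∀ t ∈ Ioo 0 T, IsDistributionOf (kochTataruBilinear u u t) (V t)) ∧
            (∀ t ∈ Ioo 0 T, FunctionSpaces.eHomBesovNorm (-1 + 3 / p.toReal) p 1 (V t) ≤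
                ENNReal.ofReal (C * a * b)) ∧
            ∀ t₀ ∈ Ioo 0 T, Tendsto
              (fun t => FunctionSpaces.eHomBesovNorm (-1 + 3 / p.toReal) p 1 (V t - V t₀))
              (𝓝[Ioo 0 T] t₀) (𝓝 0)) :
    exists_isBesovMildSolutionOn := by
  intro ν hν p q _ hp₃ hp hq₃ hq u₀ U₀ hdiv hU₀ hB
  have hq₁ : 1 ≤ q := le_of_lt (lt_of_le_of_lt (by norm_num) hq₃)
  obtain ⟨C₅, hC₅, hBES⟩ := h5 hp₃ hp
  have hdiv' : IsWeaklyDivFree (ν⁻¹ • u₀) := hdiv.const_smul ν⁻¹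
  have hU₀' : IsDistributionOf (ν⁻¹ • u₀) (((ν⁻¹ : ℝ) : ℂ) • U₀) := hU₀.const_smul ν⁻¹
  have hB' : FunctionSpaces.MemHomBesov (-1 + 3 / p.toReal) p q (((ν⁻¹ : ℝ) : ℂ) • U₀) :=
    memHomBesov_smul _ hB
  obtain ⟨T₀, hT₀, w, W, hw, hw0⟩ :=
    exists_isBesovMildSolutionOn_unit_of_duhamel hp₃ hp hq₁ hq hC₅ hBES hdiv' hU₀' hB'
  refine ⟨T₀ / ν, div_pos hT₀ hν, FluidPDE.timeRescale ν ν w, fun t => (ν : ℂ) • W (ν * t),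
    hw.timeRescale_of_unit hν, ?_⟩
  funext x
  simp [timeRescale_apply, hw0, smul_smul, mul_inv_cancel₀ hν.ne']

end Scaling

end Literature.Analysis.FluidPDE
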